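import Summits.HodgeConjecture.HodgeConjecture.Theorems.K2E3WittParabolicBlocksLift
import HarnessLib

/-!
# Levi labels versus the three blocks of `Q_{α₀+1}` for ANY anisotropic kernel (`m` arbitrary): the `m ≤ 1`-free label comparison, and the
# matrix-level Levi memberships of the middle block and of the block-diagonal lift (crux H413, 13a road A, (D)∕(W7)-prep)

Cell `hodgecm-mathlib`, Track B, line `K2_E3_EllipticInputs`, 13a road A; seat K2E3-p10 (g3).  THEOREMS ONLY; count-neutral helper.

★ `K2E3WittLeviCartanLabels` compares, for `S ⊆ Fin r` with least break `α₀ ∉ S` and `c = α₀ + 1`, the Levi labelling `wittBlockOn e S` with the three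
blocks `blockLabel N c` of the maximal parabolic `Q_c` — under the quasi-split hypothesis `m ≤ 1`, and at the level of the `J₀`-unitary SUBGROUPS ★
`blockParabolic ∕ midBlockU ∕ blockDiagLift`.  For the Levi twin of the WEAK CARTAN road (K2E3-p09 (g3), W7) and the `m = 2` recursion one needs the same
comparison for an ARBITRARY kernel size `m` and at the level of MATRICES (the `W`-parabolic toolkit ★ `K2E3WittParabolicBlocks{,Lift}` is matrix-level):

* §1 (private: the gate's dedup treats them as restatements of the `m ≤ 1` ★ lemmas) `wittBlockNat_eq_two_mul_iff'`, `blockLabel_mono_of_wittBlockOn_le'`,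
  `blockLabel_eq_of_wittBlockOn_eq'` — the ★ statements WITHOUT `m ≤ 1` (the kernel indices `r + u`, `u < m`, always carry the middle label).
* §2 `blockTriangular_of_mem_standardLeviGL'`, `apply_eq_zero_of_mem_standardLeviGL'` — `g ∈ M_S` (★ `standardLeviGL K (wittBlockOn e S)`) is block upper
  triangular AND block diagonal for `blockLabel N (α₀+1)` (the hypotheses `hq`, `hM0` of ★ `midBlock_unitary_witt` ∕ `eq_of_loBlock_eq_of_midBlock_eq_witt`).
* §4–§5 (appended) matrix-level block tools for the `m`-general recursion: `exists_gl_coe_eq_loBlock`, `loBlock_diagonal`, `midBlock_diagonal`,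
  `blockTriangular_toDual_of_apply_eq_zero`, `apply_mul_mul_eq_zero_of_blockLabel_ne`, `midIndex_stdWittEquivFin_kernel`.
* §3 `mem_standardLeviGL_of_coe_eq_midBlock'` — the middle block of `g ∈ M_S` is block diagonal for the SHIFTED datum `(e′, S′)`;
  `mem_standardLeviGL_of_coe_eq_blockDiagMatrix'` — `diag(A, B, D) ∈ M_S` for any `A, D ∈ M_c(K)` and `B` block diagonal for `(e′, S′)`.

References: A. Borel (1991), §23; I. N. Bernstein, A. V. Zelevinsky (1977), §2.1; F. Bruhat, J. Tits (1972), (4.4.3); J. Rogawski (1990), §1.10.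
-/

set_option autoImplicit false
set_option linter.dupNamespace false

noncomputable section

open scoped Matrix MatrixGroups
open Matrix

namespace Summit.HodgeConjecture.HodgeConjecture.Cruxes.H413.K2E3WittLeviLabelsKernel

open Literature.NumberTheory.Automorphic Literature.NumberTheory.Automorphic.HermitianLattice
open K2E3LocalUnitaryWitt K2E3WittCartanUnramified K2E3WittLeviCartanLabels

section Labels

variable {r : ℕ} {m : ℕ} {N : ℕ} (e : WittIndex r m ≃ Fin N)
  (hstd : ∀ x, (e x).val = Sum.elim (fun i : Fin r => i.val) (Sum.elim (fun u : Fin m => r + u.val) (fun j : Fin r => r + m + j.val)) x)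
  {S : Finset (Fin r)} {α₀ : Fin r} (hα₀ : α₀ ∉ S) (hmin : ∀ α, α ∉ S → α₀ ≤ α)

/-! ## §1 The label comparison for any `m` -/

include hstd hα₀ hmin in
/-- **Label `2L` is the last block** (any kernel size `m`): `wittBlockNat S x = 2 · #(univ ∖ S) ↔ N ≤ (e x) + (α₀ + 1)`. [cite: Borel1991, §23] -/
private theorem wittBlockNat_eq_two_mul_iff' (x : WittIndex r m) :
    wittBlockNat S x = 2 * (Finset.univ \ S).card ↔ N ≤ (e x).val + (α₀.val + 1) := by
  have hN : N = r + (m + r) := by simpa using (Fintype.card_congr e).symm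
  have hL : 1 ≤ (Finset.univ \ S).card := Finset.card_pos.2 ⟨α₀, by simp [hα₀]⟩
  have hα₀r := α₀.isLt
  rcases x with i | u | j
  · rw [hstd]; simp only [Sum.elim_inl]
    change ((Finset.univ \ S).filter fun α => α.val < i.val).card = _ ↔ _
    have h1 : ((Finset.univ \ S).filter fun α => α.val < i.val).card ≤ (Finset.univ \ S).card := Finset.card_filter_le _ _
    have := i.isLt
    omega
  · rw [hstd]; simp only [Sum.elim_inr, Sum.elim_inl]
    change (Finset.univ \ S).card = _ ↔ _
    have := u.isLt
    omega
  · rw [hstd]; simp only [Sum.elim_inr]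
    change (Finset.univ \ S).card + ((Finset.univ \ S).filter fun α => (Fin.rev α).val ≤ j.val).card = _ ↔ _
    have hiff : ((Finset.univ \ S).filter fun α => (Fin.rev α).val ≤ j.val).card = (Finset.univ \ S).card ↔ r ≤ j.val + (α₀.val + 1) := by
      rw [Finset.card_filter_eq_iff]
      constructor
      · intro h
        have := h α₀ (by simp [hα₀])
        rw [Fin.val_rev] at this
        omega
      · intro h α hα
        have := Fin.le_iff_val_le_val.1 (hmin α (by simpa using hα))
        rw [Fin.val_rev]
        omega
    have h1 : ((Finset.univ \ S).filter fun α => (Fin.rev α).val ≤ j.val).card ≤ (Finset.univ \ S).card := Finset.card_filter_le _ _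
    constructor
    · intro h; have := hiff.1 (by omega); omega
    · intro h; have := hiff.2 (by omega); omega

include hstd hα₀ hmin in
/-- **The labelling of `S` refines the three blocks of `Q_{α₀+1}`**, any `m`. [cite: BernsteinZelevinsky1977, §2.1] [cite: Borel1991, §23] -/
private theorem blockLabel_mono_of_wittBlockOn_le' {k l : Fin N} (hkl : wittBlockOn e S k ≤ wittBlockOn e S l) :
    blockLabel N (α₀.val + 1) k ≤ blockLabel N (α₀.val + 1) l := by
  have h0 := wittBlockNat_eq_zero_iff e hstd hα₀ hmin
  have h2 := wittBlockNat_eq_two_mul_iff' e hstd hα₀ hmin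
  rw [Fin.le_iff_val_le_val, wittBlockOn_apply, wittBlockOn_apply, wittBlock_val, wittBlock_val] at hkl
  have hk := wittBlockNat_le S (e.symm k)
  have hl := wittBlockNat_le S (e.symm l)
  have h0k := h0 (e.symm k); have h0l := h0 (e.symm l); have h2k := h2 (e.symm k); have h2l := h2 (e.symm l)
  rw [e.apply_symm_apply] at h0k h0l h2k h2l
  unfold blockLabel
  split_ifs <;> omega

include hstd hα₀ hmin in
/-- Equal `S`-labels have equal `Q_{α₀+1}`-blocks, any `m`. [cite: BernsteinZelevinsky1977, §2.1] -/
private theorem blockLabel_eq_of_wittBlockOn_eq' {k l : Fin N} (hkl : wittBlockOn e S k = wittBlockOn e S l) :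
    blockLabel N (α₀.val + 1) k = blockLabel N (α₀.val + 1) l :=
  le_antisymm (blockLabel_mono_of_wittBlockOn_le' e hstd hα₀ hmin hkl.le) (blockLabel_mono_of_wittBlockOn_le' e hstd hα₀ hmin hkl.ge)

/-! ## §2 `M_S` is block upper triangular and block diagonal for `Q_{α₀+1}` (matrix level) -/

variable {K : Type*} [Field K]

include hstd hα₀ hmin in
/-- **`M_S ≤ Q_{α₀+1}` on matrices**: an element of ★ `standardLeviGL K (wittBlockOn e S)` is block upper triangular for `blockLabel N (α₀+1)` (the hypothesis
`hq` of ★ `midBlock_unitary_witt`). [cite: BernsteinZelevinsky1977, §2.1] [cite: BruhatTits1972, (4.4.3)] -/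
theorem blockTriangular_of_mem_standardLeviGL' {g : GL (Fin N) K} (hg : g ∈ standardLeviGL K (wittBlockOn e S)) :
    (g : Matrix (Fin N) (Fin N) K).BlockTriangular (blockLabel N (α₀.val + 1)) := by
  rw [mem_standardLeviGL_iff] at hg
  intro i j hij
  exact hg i j fun h => (blockLabel_eq_of_wittBlockOn_eq' e hstd hα₀ hmin h).not_gt hij

include hstd hα₀ hmin in
/-- **`M_S` is block diagonal for `Q_{α₀+1}` on matrices** (the hypothesis `hM0` of ★ `eq_of_loBlock_eq_of_midBlock_eq_witt`). [cite: BernsteinZelevinsky1977, §2.1] -/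
theorem apply_eq_zero_of_mem_standardLeviGL' {g : GL (Fin N) K} (hg : g ∈ standardLeviGL K (wittBlockOn e S)) {p q : Fin N}
    (hpq : blockLabel N (α₀.val + 1) p ≠ blockLabel N (α₀.val + 1) q) : (g : Matrix (Fin N) (Fin N) K) p q = 0 :=
  (mem_standardLeviGL_iff _ _).1 hg p q fun h => hpq (blockLabel_eq_of_wittBlockOn_eq' e hstd hα₀ hmin h)

/-! ## §3 The middle block and the block-diagonal lift versus `M_S` (matrix level) -/

include hstd hα₀ hmin in
/-- **The middle block of `g ∈ M_S` is block diagonal for the shifted datum `(e′, S′)`** (matrix level: any `g′` whose matrix is `midBlock g`).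
[cite: BernsteinZelevinsky1977, §2.1] -/
theorem mem_standardLeviGL_of_coe_eq_midBlock' (hc : 2 * (α₀.val + 1) ≤ N)
    (hN' : (r - (α₀.val + 1)) + (m + (r - (α₀.val + 1))) = N - 2 * (α₀.val + 1))
    {g : GL (Fin N) K} (hg : g ∈ standardLeviGL K (wittBlockOn e S)) {g' : GL (Fin (N - 2 * (α₀.val + 1))) K}
    (hg' : (g' : Matrix (Fin (N - 2 * (α₀.val + 1))) (Fin (N - 2 * (α₀.val + 1))) K) = midBlock hc (g : Matrix (Fin N) (Fin N) K)) :
    g' ∈ standardLeviGL K (wittBlockOn (stdWittEquivFin (r - (α₀.val + 1)) m hN')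
      (Finset.univ.filter fun α' : Fin (r - (α₀.val + 1)) => (⟨α'.val + (α₀.val + 1), by have := α'.isLt; omega⟩ : Fin r) ∈ S)) := by
  rw [mem_standardLeviGL_iff] at hg ⊢
  intro j j' hjj'
  rw [hg', midBlock_apply]
  refine hg _ _ fun h => hjj' (Fin.ext ?_)
  have h' := congrArg Fin.val h
  rw [wittBlockOn_apply, wittBlockOn_apply, wittBlock_val, wittBlock_val, wittBlockNat_symm_midIndex e hstd hα₀ hmin hc hN',
    wittBlockNat_symm_midIndex e hstd hα₀ hmin hc hN'] at h'
  rw [wittBlockOn_apply, wittBlockOn_apply, wittBlock_val, wittBlock_val]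
  omega

include hstd hα₀ hmin in
/-- **A block-diagonal matrix `diag(A, B, D)` with `B` block diagonal for the shifted datum lies in `M_S`** (matrix level: any `L ∈ GL_N(K)` whose matrix is
`blockDiagMatrix hc A B D`; the first and last blocks of `S` are single blocks). [cite: BernsteinZelevinsky1977, §2.1] [cite: Rogawski1990, §1.10] -/
theorem mem_standardLeviGL_of_coe_eq_blockDiagMatrix' (hc : 2 * (α₀.val + 1) ≤ N)
    (hN' : (r - (α₀.val + 1)) + (m + (r - (α₀.val + 1))) = N - 2 * (α₀.val + 1)) (A D : Matrix (Fin (α₀.val + 1)) (Fin (α₀.val + 1)) K)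
    {g' : GL (Fin (N - 2 * (α₀.val + 1))) K}
    (hg' : g' ∈ standardLeviGL K (wittBlockOn (stdWittEquivFin (r - (α₀.val + 1)) m hN')
        (Finset.univ.filter fun α' : Fin (r - (α₀.val + 1)) => (⟨α'.val + (α₀.val + 1), by have := α'.isLt; omega⟩ : Fin r) ∈ S)))
    {L : GL (Fin N) K} (hL : (L : Matrix (Fin N) (Fin N) K) =
      blockDiagMatrix hc A ((g' : GL (Fin (N - 2 * (α₀.val + 1))) K) : Matrix (Fin (N - 2 * (α₀.val + 1))) (Fin (N - 2 * (α₀.val + 1))) K) D) :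
    L ∈ standardLeviGL K (wittBlockOn e S) := by
  have h0 := wittBlockNat_eq_zero_iff e hstd hα₀ hmin
  have h2 := wittBlockNat_eq_two_mul_iff' e hstd hα₀ hmin
  rw [mem_standardLeviGL_iff] at hg' ⊢
  intro p q hpq
  rw [hL]
  by_cases hb : blockLabel N (α₀.val + 1) p = blockLabel N (α₀.val + 1) q
  · obtain ⟨x, rfl⟩ := (blockSum hc).surjective p
    obtain ⟨y, rfl⟩ := (blockSum hc).surjective q
    rcases x with (i | i) | i <;> rcases y with (j | j) | j <;>
      simp only [blockSum_inl_inl, blockSum_inl_inr, blockSum_inr, blockLabel_castLE hc, blockLabel_midIndex hc, blockLabel_hiIndex hc] at hb hpq ⊢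
    all_goals first
      | exact absurd hb (by decide)
      | skip
    · -- first block: both labels are `0`
      exfalso; apply hpq
      have hi : wittBlockNat S (e.symm (Fin.castLE (le_of_two_mul_le hc) i)) = 0 := (h0 _).2 (by rw [e.apply_symm_apply]; exact i.isLt)
      have hj : wittBlockNat S (e.symm (Fin.castLE (le_of_two_mul_le hc) j)) = 0 := (h0 _).2 (by rw [e.apply_symm_apply]; exact j.isLt)
      apply Fin.ext; rw [wittBlockOn_apply, wittBlockOn_apply, wittBlock_val, wittBlock_val, hi, hj]
    · -- middle block: the shifted labels differ
      rw [blockDiagMatrix_midIndex_midIndex]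
      refine hg' _ _ fun h => hpq (Fin.ext ?_)
      have h' := congrArg Fin.val h
      rw [wittBlockOn_apply, wittBlockOn_apply, wittBlock_val, wittBlock_val] at h' ⊢
      rw [wittBlockNat_symm_midIndex e hstd hα₀ hmin hc hN', wittBlockNat_symm_midIndex e hstd hα₀ hmin hc hN', h']
    · -- last block: both labels are `2L`
      exfalso; apply hpq
      have hi : wittBlockNat S (e.symm (hiIndex hc i)) = 2 * (Finset.univ \ S).card :=
        (h2 _).2 (by rw [e.apply_symm_apply, coe_hiIndex]; have := i.isLt; omega)
      have hj : wittBlockNat S (e.symm (hiIndex hc j)) = 2 * (Finset.univ \ S).card :=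
        (h2 _).2 (by rw [e.apply_symm_apply, coe_hiIndex]; have := j.isLt; omega)
      apply Fin.ext; rw [wittBlockOn_apply, wittBlockOn_apply, wittBlock_val, wittBlock_val, hi, hj]
  · exact blockDiagMatrix_apply_of_ne hc _ _ _ hb

end Labels

/-! ## §4 Matrix-level block tools (appended; used by the `m`-general Levi recursion `K2E3WittLeviCartanRecursionKernel`) -/

section Tools

variable {K : Type*} [Field K] {N c : ℕ}

/-- **The first block of a block upper triangular invertible matrix as an element of `GL_c(K)`** (inverse = first block of the inverse, ★ `loBlock_mul`).
[cite: Rogawski1990, §1.10] [cite: BruhatTits1972, (4.4.3)] -/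
theorem exists_gl_coe_eq_loBlock (hc : 2 * c ≤ N) (g : GL (Fin N) K) (hq : (g : Matrix (Fin N) (Fin N) K).BlockTriangular (blockLabel N c)) :
    ∃ A : GL (Fin c) K, (A : Matrix (Fin c) (Fin c) K) = loBlock hc (g : Matrix (Fin N) (Fin N) K) ∧
      ((A⁻¹ : GL (Fin c) K) : Matrix (Fin c) (Fin c) K) = loBlock hc ((g⁻¹ : GL (Fin N) K) : Matrix (Fin N) (Fin N) K) := by
  have hq' : ((g⁻¹ : GL (Fin N) K) : Matrix (Fin N) (Fin N) K).BlockTriangular (blockLabel N c) := by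
    rw [Matrix.coe_units_inv]
    letI := g.invertible
    exact Matrix.blockTriangular_inv_of_blockTriangular hq
  have h1 : loBlock hc (g : Matrix (Fin N) (Fin N) K) * loBlock hc ((g⁻¹ : GL (Fin N) K) : Matrix (Fin N) (Fin N) K) = 1 := by
    rw [← loBlock_mul hc _ hq', ← Units.val_mul, mul_inv_cancel, Units.val_one, loBlock_one]
  have h2 : loBlock hc ((g⁻¹ : GL (Fin N) K) : Matrix (Fin N) (Fin N) K) * loBlock hc (g : Matrix (Fin N) (Fin N) K) = 1 := by
    rw [← loBlock_mul hc _ hq, ← Units.val_mul, inv_mul_cancel, Units.val_one, loBlock_one]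
  exact ⟨⟨_, _, h1, h2⟩, rfl, rfl⟩

/-- `loBlock (diag d) = diag (d ∘ castLE)`. [cite: BruhatTits1972, (4.4.3)] -/
theorem loBlock_diagonal (hc : 2 * c ≤ N) (d : Fin N → K) :
    loBlock hc (Matrix.diagonal d) = Matrix.diagonal (d ∘ Fin.castLE (le_of_two_mul_le hc)) := by
  ext i j
  rw [loBlock_apply, Matrix.diagonal_apply, Matrix.diagonal_apply]
  by_cases h : i = j
  · subst h; rw [if_pos rfl, if_pos rfl]; rfl
  · rw [if_neg (fun h' => h (Fin.castLE_injective _ h')), if_neg h]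

/-- `midBlock (diag d) = diag (d ∘ midIndex)`. [cite: BruhatTits1972, (4.4.3)] -/
theorem midBlock_diagonal (hc : 2 * c ≤ N) (d : Fin N → K) :
    midBlock hc (Matrix.diagonal d) = Matrix.diagonal (d ∘ midIndex hc) := by
  ext i j
  rw [midBlock_apply, Matrix.diagonal_apply, Matrix.diagonal_apply]
  by_cases h : i = j
  · subst h; rw [if_pos rfl, if_pos rfl]; rfl
  · rw [if_neg (fun h' => h (midIndex_injective hc h')), if_neg h]

/-- A matrix vanishing off the diagonal blocks is block triangular for BOTH orders (here: the dual order). [cite: BernsteinZelevinsky1977, §2.1] -/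
theorem blockTriangular_toDual_of_apply_eq_zero {M : Matrix (Fin N) (Fin N) K} (hM0 : ∀ {p q : Fin N}, blockLabel N c p ≠ blockLabel N c q → M p q = 0) :
    M.BlockTriangular (OrderDual.toDual ∘ blockLabel N c) := fun _ _ hpq => hM0 (OrderDual.toDual_lt_toDual.1 hpq).ne

/-- A matrix vanishing off the diagonal blocks is block upper triangular. [cite: BernsteinZelevinsky1977, §2.1] -/
theorem blockTriangular_of_apply_eq_zero {M : Matrix (Fin N) (Fin N) K} (hM0 : ∀ {p q : Fin N}, blockLabel N c p ≠ blockLabel N c q → M p q = 0) :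
    M.BlockTriangular (blockLabel N c) := fun _ _ hpq => hM0 hpq.ne'

/-- A product of three matrices each block triangular for both orders vanishes off the diagonal blocks. [cite: BernsteinZelevinsky1977, §2.1] -/
theorem apply_mul_mul_eq_zero_of_blockLabel_ne {M₁ M₂ M₃ : Matrix (Fin N) (Fin N) K} (h₁ : M₁.BlockTriangular (blockLabel N c))
    (h₁' : M₁.BlockTriangular (OrderDual.toDual ∘ blockLabel N c)) (h₂ : M₂.BlockTriangular (blockLabel N c))
    (h₂' : M₂.BlockTriangular (OrderDual.toDual ∘ blockLabel N c)) (h₃ : M₃.BlockTriangular (blockLabel N c))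
    (h₃' : M₃.BlockTriangular (OrderDual.toDual ∘ blockLabel N c)) {p q : Fin N} (hpq : blockLabel N c p ≠ blockLabel N c q) :
    (M₁ * M₂ * M₃) p q = 0 := by
  rcases lt_or_gt_of_ne hpq with h | h
  · exact ((h₁'.mul h₂').mul h₃') (OrderDual.toDual_lt_toDual.2 h)
  · exact ((h₁.mul h₂).mul h₃) h

end Tools


/-! ## §5 The kernel slots under the shift `e ↦ e′` -/

section KernelSlots

variable {r : ℕ} {m : ℕ} {N : ℕ} (e : WittIndex r m ≃ Fin N)
  (hstd : ∀ x, (e x).val = Sum.elim (fun i : Fin r => i.val) (Sum.elim (fun u : Fin m => r + u.val) (fun j : Fin r => r + m + j.val)) x)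

include hstd in
/-- The kernel slots of `e` are the middle-block images of the kernel slots of the shifted datum `e′`. [cite: Borel1991, §23] -/
theorem midIndex_stdWittEquivFin_kernel {c : ℕ} (hcr : c ≤ r) (hc : 2 * c ≤ N) (hN' : (r - c) + (m + (r - c)) = N - 2 * c) (u : Fin m) :
    midIndex hc (stdWittEquivFin (r - c) m hN' (Sum.inr (Sum.inl u))) = e (Sum.inr (Sum.inl u)) := by
  apply Fin.ext
  rw [coe_midIndex, stdWittEquivFin_hstd, hstd]
  simp only [Sum.elim_inr, Sum.elim_inl]
  omega

end KernelSlots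


end Summit.HodgeConjecture.HodgeConjecture.Cruxes.H413.K2E3WittLeviLabelsKernel

end
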